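import Summits.QuantumFields.BalabanUV.T4Continuum.Support.AveragingDeficitFaceLift
import Summits.QuantumFields.BalabanUV.T4Continuum.Support.SkeletonLattice

/-!
# SpreadLiftWords (T⁴ programme, node NE3, crew row S6-Y7 (c) `replicationRightInverse`, file 1/5) — CROSSING BONDS ON
# THE WORDS OF BAŁABAN'S AVERAGE (42), THE COVARIANT SPREAD LIFT OF COARSE DATA, AND ITS LINEARISED TRANSPORT ALONG THE
# CONTOURS: `(δ_ψV)(loop_{c,x}) = Ad_{V(Γ_{≤b_x})}ψ(b_x) − Ad_{V(Γ_{c,x})}ψ(b₀(c))`, `Φ(c) = ψ(b₀(c)) + Ad_{V(Γ_c)⁻¹}J_{X_c}(X_c′)`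

HONEST FRAMING (cell `pub-balaban`, T4-DAG PAGE 1; unit `b2b-balaban-t4-ne3-formalise-leaf-01` gen 3, NE3 (node U1b)
formalisation swarm, crew sub-row **S6-Y7 (c)** of `t4/formal/NE3/LEAVES.md` = leaf **L7(c) `replicationRightInverse`** of
the road-P3 skeleton `t4/skeletons/NE3-t4-ne3-p3.md` §2).  The cell's T4 target is the finite-torus continuum limit of the
unit-scale averaged loop expectations — NOT infinite volume, NO mass gap, NOT Clay, NOT summit progress.  Road P3's
composition §1 (E0) decomposes a fine direction `X` as `(X − Q_R·DQ̄[X]) + Q_R·DQ̄[X]` with `Q_R` an EXPLICIT LINEAR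
RIGHT INVERSE of the differential `DQ̄` of the (iterated) average (42); row NE3-R2's lift `AveragingDeficitFaceLift.exists_lift`
(one FACE bond `b₀(c)` per coarse bond) inverts `DQ̄` with the bound `2L^d` under the smallness `liftSmall ∝ L^{d+2}`,
because ONE face bond is seen by only the `L` on-axis contours out of `L^d` (`AveragingDeficitLiftMap.axisWeight = L^{1−d}`).
THIS FILE starts the `L`-UNIFORM sibling: the value is SPREAD over ALL `L^{d−1}` CROSSING bonds
`⟨Ly + r⊥ + (L−1)e_κ, +e_κ⟩` of the coarse bond `c = (y, κ)` and PARALLEL-TRANSPORTED to each of them from the corner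
`L(y + e_κ)` of the next block along the tree contour (so that in that block's axial gauge the direction is constant on the
face): every contour `Γ_{c,x}` then picks the value up exactly once and `−Γ_c` gives it back.  All [folklore], 0 sorry:
§1 crossing bonds (`IsCross L z i :⟺ z_i ≡ L−1 (mod L)`, `crossOff`, `perpOff`, block arithmetic); §2 ON THE WORDS OF `c`
(classification): tree words carry no crossing bond (`not_isCross_of_mem_treeWord`), the straight contour from `x = Ly + r`
carries exactly one, at height `L−1−r_κ` (`isCross_seg_iff`), the reversed central contour exactly `b₀(c)` as its first bond
(`isCross_back_iff`); §3 cross-supported directions along the words (`dhol_treeWord_eq_zero`, `dhol_seg_cross`,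
`dhol_central`, `dhol_back`, **`dhol_loopWord`**, **`pushDir_crossSupported`**).
Files 2–5: `SpreadLiftDirection` (the spread lift `spreadLift L V φ` and the lift map of a coarse bond), `SpreadLiftMap` (the
map is `id + O(dL²a)` and invertible), `SpreadLift` (the one-level right inverse), `ReplicationRightInverse` (the tower).  NOT NE3 in disguise: word combinatorics of ONE averaging operator at ONE
background; no minimiser, no two-spacing comparison, no rate.  NE3 is NOT proved by this file.
CITATION HEADER: no printed sentence is a hypothesis; the manuscripts under audit are not cited for any disputed step;
context: T. Bałaban, Commun. Math. Phys. **98** (1985) 17–51 [Balaban1985Averaging] ((9) p. 18, (14) p. 19, (42) p. 23,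
p. 24–25, (139)–(147) p. 39–40); **95** (1984) 17–40 [Balaban1984PropagatorsI] ((1.6)–(1.8) p. 18).
PLACEMENT: `Summits/QuantumFields/BalabanUV/` (human rule 2026-08-19).  Record: HOME `t4/formal/NE3/LEAVES.md` row S5∕S6.
-/

set_option autoImplicit false

open scoped BigOperators Matrix Matrix.Norms.L2Operator Topology
open NormedSpace Finset Filter

namespace Summit.QuantumFields.BalabanUV.T4Continuum.SpreadLiftWords

open Literature.MathematicalPhysics.QuantumFieldTheory.Balaban1983to89
open B7Prop1Explicit B7Prop2Explicit MatrixLog UnitaryModel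
open T4AveragingDeficitWall hiding Site Plane Plaq Bond
open T4AveragingDeficitNonAbelian (Ad_mul Ad_sub)
open AveragingDeficitTransport AveragingDeficitLocality AveragingDeficitNearIdentity AveragingDeficitSideDeriv
open AveragingDeficitResidualPairing AveragingDeficitTransportCalc AveragingDeficitPushForwardLinear
open AveragingDeficitFaceWords (faceSite boxVec_bounds)
open SkeletonLattice (cdiv cmod smul_cdiv_add_cmod cmod_nonneg cmod_lt cdiv_eq_of_repr cmod_eq_of_repr)

noncomputable section

variable {d : ℕ} {n : Type*} [Fintype n] [DecidableEq n]

/-! ## §1 Crossing bonds and block arithmetic -/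

/-- `(z, i)` is a CROSSING bond: the fine bond `⟨z, z + e_i⟩` crosses a face of the `L`-block lattice, i.e. the in-block
offset of `z` in direction `i` is `L − 1`. [folklore] -/
def IsCross (L : ℕ) (z : Site d) (i : Fin d) : Prop := cmod L z i = (L : ℤ) - 1

/-- `IsCross` is decidable. [folklore] -/
instance instDecidableIsCross (L : ℕ) (z : Site d) (i : Fin d) : Decidable (IsCross L z i) := by
  unfold IsCross; infer_instance

/-- The block offset of the crossing bond on the straight contour from `Ly + r` in direction `κ`: `r` with its `κ`-th
component replaced by `L − 1`. [folklore] -/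
def crossOff {L : ℕ} (hL : 1 ≤ L) (κ : Fin d) (r : Fin d → Fin L) : Fin d → Fin L :=
  fun j => if j = κ then ⟨L - 1, by omega⟩ else r j

/-- The transverse part of a block offset: `r` with its `κ`-th component replaced by `0`. [folklore] -/
def perpOff {L : ℕ} (hL : 1 ≤ L) (κ : Fin d) (r : Fin d → Fin L) : Fin d → Fin L :=
  fun j => if j = κ then ⟨0, by omega⟩ else r j

omit [Fintype n] [DecidableEq n] in
/-- `boxVec (crossOff r) = boxVec r + (L − 1 − r_κ)e_κ`. [folklore] -/
theorem boxVec_crossOff {L : ℕ} (hL : 1 ≤ L) (κ : Fin d) (r : Fin d → Fin L) :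
    boxVec L (crossOff hL κ r) = boxVec L r + ((L - 1 - (r κ : ℕ) : ℕ) : ℤ) • e κ := by
  funext j
  have hr : (r κ : ℕ) < L := (r κ).isLt
  simp only [boxVec, crossOff, Pi.add_apply, Pi.smul_apply, e_apply, smul_eq_mul]
  split_ifs with h
  · subst h; push_cast; omega
  · simp

omit [Fintype n] [DecidableEq n] in
/-- `boxVec (crossOff r) + e_κ = Le_κ + boxVec (perpOff r)` (the crossing bond ends on the face of the next block).
[folklore] -/
theorem boxVec_crossOff_add_e {L : ℕ} (hL : 1 ≤ L) (κ : Fin d) (r : Fin d → Fin L) :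
    boxVec L (crossOff hL κ r) + e κ = (L : ℤ) • e κ + boxVec L (perpOff hL κ r) := by
  funext j
  simp only [boxVec, crossOff, perpOff, Pi.add_apply, Pi.smul_apply, e_apply, smul_eq_mul]
  split_ifs with h
  · subst h; push_cast; omega
  · simp

omit [Fintype n] [DecidableEq n] in
/-- `boxVec (perpOff r) + r_κ e_κ = boxVec r`. [folklore] -/
theorem boxVec_perpOff_add {L : ℕ} (hL : 1 ≤ L) (κ : Fin d) (r : Fin d → Fin L) :
    boxVec L (perpOff hL κ r) + ((r κ : ℕ) : ℤ) • e κ = boxVec L r := by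
  funext j
  simp only [boxVec, perpOff, Pi.add_apply, Pi.smul_apply, e_apply, smul_eq_mul]
  split_ifs with h
  · subst h; simp
  · simp

omit [Fintype n] [DecidableEq n] in
/-- `perpOff (crossOff r) = perpOff r`. [folklore] -/
theorem perpOff_crossOff {L : ℕ} (hL : 1 ≤ L) (κ : Fin d) (r : Fin d → Fin L) :
    perpOff hL κ (crossOff hL κ r) = perpOff hL κ r := by
  funext j; simp only [perpOff, crossOff]; split_ifs <;> rfl

omit [Fintype n] [DecidableEq n] in
/-- The coarse site of a block point. [folklore] -/
theorem cdiv_smul_add_boxVec (L : ℕ) (y : Site d) (r : Fin d → Fin L) : cdiv L ((L : ℤ) • y + boxVec L r) = y :=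
  cdiv_eq_of_repr rfl (fun i => (boxVec_bounds L r i).1) (fun i => (boxVec_bounds L r i).2)

omit [Fintype n] [DecidableEq n] in
/-- The in-block offset of a block point. [folklore] -/
theorem cmod_smul_add_boxVec (L : ℕ) (y : Site d) (r : Fin d → Fin L) : cmod L ((L : ℤ) • y + boxVec L r) = boxVec L r :=
  cmod_eq_of_repr rfl (fun i => (boxVec_bounds L r i).1) (fun i => (boxVec_bounds L r i).2)

omit [Fintype n] [DecidableEq n] in
/-- A block point is the start of a crossing bond in direction `i` iff its offset is `L − 1` there. [folklore] -/
theorem isCross_smul_add_boxVec_iff (L : ℕ) (y : Site d) (r : Fin d → Fin L) (i : Fin d) :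
    IsCross L ((L : ℤ) • y + boxVec L r) i ↔ ((r i : ℕ) : ℤ) = (L : ℤ) - 1 := by
  unfold IsCross
  rw [cmod_smul_add_boxVec]
  rfl

omit [Fintype n] [DecidableEq n] in
/-- `Ly + boxVec (crossOff r)` starts a crossing bond in direction `κ`. [folklore] -/
theorem isCross_crossOff {L : ℕ} (hL : 1 ≤ L) (y : Site d) (κ : Fin d) (r : Fin d → Fin L) :
    IsCross L ((L : ℤ) • y + boxVec L (crossOff hL κ r)) κ := by
  rw [isCross_smul_add_boxVec_iff]
  simp only [crossOff, if_true]
  omega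

omit [Fintype n] [DecidableEq n] in
/-- The face site `b₀(c)₋ = Ly + (L−1)e_κ` is the block point of offset `crossOff 0`. [folklore] -/
theorem faceSite_eq {L : ℕ} (hL : 1 ≤ L) (y : Site d) (κ : Fin d) :
    faceSite L y κ = (L : ℤ) • y + boxVec L (crossOff hL κ (fun _ => ⟨0, by omega⟩)) := by
  funext j
  simp only [faceSite, boxVec, crossOff, Pi.add_apply, Pi.smul_apply, e_apply, smul_eq_mul]
  split_ifs with h
  · push_cast; omega
  · simp

omit [Fintype n] [DecidableEq n] in
/-- The face site starts a crossing bond in direction `κ`. [folklore] -/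
theorem isCross_faceSite {L : ℕ} (hL : 1 ≤ L) (y : Site d) (κ : Fin d) : IsCross L (faceSite L y κ) κ := by
  rw [faceSite_eq hL]; exact isCross_crossOff hL y κ _

omit [Fintype n] [DecidableEq n] in
/-- The coarse site of the face site. [folklore] -/
theorem cdiv_faceSite {L : ℕ} (hL : 1 ≤ L) (y : Site d) (κ : Fin d) : cdiv L (faceSite L y κ) = y := by
  rw [faceSite_eq hL, cdiv_smul_add_boxVec]

omit [Fintype n] [DecidableEq n] in
/-- Residue arithmetic: for `0 ≤ t < 2L − 1`, `(L·y + t) mod L = L − 1 ⟺ t = L − 1`. [folklore] -/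
theorem emod_coord_iff {L : ℕ} (hL : 1 ≤ L) (y t : ℤ) (ht0 : 0 ≤ t) (htL : t < 2 * (L : ℤ) - 1) :
    ((L : ℤ) * y + t) % (L : ℤ) = (L : ℤ) - 1 ↔ t = (L : ℤ) - 1 := by
  have hL0 : (0 : ℤ) < L := by exact_mod_cast (by omega : 0 < L)
  rw [show (L : ℤ) * y + t = t + y * (L : ℤ) by ring, Int.add_mul_emod_self_right]
  by_cases h : t < L
  · rw [Int.emod_eq_of_lt ht0 h]
  · have e : t = (t - L) + 1 * (L : ℤ) := by ring
    rw [e, Int.add_mul_emod_self_right, Int.emod_eq_of_lt (by omega) (by omega)]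
    omega

/-! ## §2 On the words of `c` the crossing bonds are: one per straight contour, and `b₀(c)` -/

omit [Fintype n] [DecidableEq n] in
/-- **Tree words from a block corner carry no crossing bond** (their bonds stay below the far faces of the block).
[cite: Balaban1985Averaging, p.24] -/
theorem not_isCross_of_mem_treeWord {L : ℕ} (hL : 1 ≤ L) (y : Site d) (r : Fin d → Fin L) {b : Site d × Fin d}
    (hb : b ∈ bondsOf ((L : ℤ) • y) (treeWord (boxVec L r))) : ¬ IsCross L b.1 b.2 := by
  intro hc
  obtain ⟨h1, h2⟩ := bondsOf_treeWord_lt _ (fun i => (boxVec_bounds L r i).1) _ b hb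
  have hrb := (boxVec_bounds L r b.2).2
  simp only [Pi.smul_apply, smul_eq_mul] at h1 h2
  unfold IsCross cmod at hc
  set t : ℤ := b.1 b.2 - (L : ℤ) * y b.2 with ht
  have e : b.1 b.2 = (L : ℤ) * y b.2 + t := by rw [ht]; ring
  rw [e] at hc
  have := (emod_coord_iff hL (y b.2) t (by omega) (by omega)).mp hc
  omega

omit [Fintype n] [DecidableEq n] in
/-- **The straight contour from `x = Ly + r` carries a crossing bond exactly at height `L − 1 − r_κ`.**
[cite: Balaban1985Averaging, (14) p.19, (42) p.23] -/
theorem isCross_seg_iff {L : ℕ} (hL : 1 ≤ L) (y : Site d) (κ : Fin d) (r : Fin d → Fin L) {j : ℕ} (hj : j < L) :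
    IsCross L ((L : ℤ) • y + boxVec L r + (j : ℤ) • e κ) κ ↔ j = L - 1 - (r κ : ℕ) := by
  have hr := (r κ).isLt
  unfold IsCross cmod
  simp only [Pi.add_apply, Pi.smul_apply, smul_eq_mul, e_apply, if_true, mul_one, boxVec]
  rw [add_assoc, emod_coord_iff hL (y κ) _ (by positivity) (by omega)]
  omega

omit [Fintype n] [DecidableEq n] in
/-- On the straight contour from `x = Ly + r`, a crossing bond is THE crossing bond `⟨Ly + crossOff r, +e_κ⟩`. [folklore] -/
theorem eq_of_mem_seg_isCross {L : ℕ} (hL : 1 ≤ L) (y : Site d) (κ : Fin d) (r : Fin d → Fin L) {b : Site d × Fin d}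
    (hb : b ∈ bondsOf ((L : ℤ) • y + boxVec L r) (seg κ (L : ℤ))) (hc : IsCross L b.1 b.2) :
    b = ((L : ℤ) • y + boxVec L (crossOff hL κ r), κ) := by
  obtain ⟨j, hj, rfl⟩ := (mem_bondsOf_seg_iff _ κ L b).mp hb
  have hj' := (isCross_seg_iff hL y κ r hj).mp hc
  subst hj'
  rw [boxVec_crossOff, add_assoc]

omit [Fintype n] [DecidableEq n] in
/-- **The reversed central contour (from `Ly + Le_κ`) carries a crossing bond only as its FIRST bond (`j = 0`), `b₀(c)`.**
[folklore] -/
theorem isCross_back_iff {L : ℕ} (hL : 1 ≤ L) (y : Site d) (κ : Fin d) {j : ℕ} (hj : j < L) :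
    IsCross L ((L : ℤ) • y + (L : ℤ) • e κ - ((j : ℤ) + 1) • e κ) κ ↔ j = 0 := by
  unfold IsCross cmod
  simp only [Pi.add_apply, Pi.sub_apply, Pi.smul_apply, smul_eq_mul, e_apply, if_true, mul_one]
  rw [show (L : ℤ) * y κ + (L : ℤ) - ((j : ℤ) + 1) = (L : ℤ) * y κ + ((L : ℤ) - 1 - j) by ring,
    emod_coord_iff hL (y κ) _ (by omega) (by omega)]
  omega

/-! ## §3 Cross-supported directions along the words of (42) -/

/-- A direction SUPPORTED ON CROSSING BONDS: zero off the crossing bonds. [folklore] -/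
def CrossSupported (L : ℕ) (ψ : Site d → Fin d → (Matrix n n ℂ)) : Prop := ∀ (z : Site d) (i : Fin d), ¬ IsCross L z i → ψ z i = 0

/-- Tree words from a block corner: `(δ_ψV) = 0` for a cross-supported `ψ`. [folklore] -/
theorem dhol_treeWord_eq_zero {L : ℕ} {V : Site d → Fin d → (Matrix n n ℂ)ˣ} {ψ : Site d → Fin d → (Matrix n n ℂ)} (hL : 1 ≤ L)
    (hψ : CrossSupported L ψ) (y : Site d) (r : Fin d → Fin L) :
    dhol V ψ ((L : ℤ) • y) (treeWord (boxVec L r)) = 0 :=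
  dhol_eq_zero_of_forall V _ _ fun _ hb => hψ _ _ (not_isCross_of_mem_treeWord hL y r hb)

/-- **The straight contour from `x = Ly + r`**: `(δ_ψV)(Γ) = Ad_{V(x, …, b_x₊)} ψ(b_x)`, `b_x = ⟨Ly + crossOff r, +e_κ⟩`, the
transport running up to and including the crossing bond. [cite: Balaban1985Averaging, (9) p.18, (42) p.23] -/
theorem dhol_seg_cross {L : ℕ} {V : Site d → Fin d → (Matrix n n ℂ)ˣ} {ψ : Site d → Fin d → (Matrix n n ℂ)} (hL : 1 ≤ L)
    (hψ : CrossSupported L ψ) (y : Site d) (κ : Fin d) (r : Fin d → Fin L) :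
    dhol V ψ ((L : ℤ) • y + boxVec L r) (seg κ (L : ℤ))
      = Ad (hol V ((L : ℤ) • y + boxVec L r) (seg κ (((L - 1 - (r κ : ℕ) : ℕ) : ℤ) + 1)))
          (ψ ((L : ℤ) • y + boxVec L (crossOff hL κ r)) κ) := by
  have hr := (r κ).isLt
  have h := dhol_seg_single V (ψ := ψ) ((L : ℤ) • y + boxVec L r) κ (k := L) (j₀ := L - 1 - (r κ : ℕ)) (by omega)
    fun j hj hne => hψ _ _ fun hc => hne ((isCross_seg_iff hL y κ r hj).mp hc)
  rw [h, boxVec_crossOff, add_assoc]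

/-- The central contour: `(δ_ψV)(Γ_c) = Ad_{V(Γ_c)} ψ(b₀)`. [cite: Balaban1985Averaging, (9) p.18, (42) p.23] -/
theorem dhol_central {L : ℕ} {V : Site d → Fin d → (Matrix n n ℂ)ˣ} {ψ : Site d → Fin d → (Matrix n n ℂ)} (hL : 1 ≤ L)
    (hψ : CrossSupported L ψ) (y : Site d) (κ : Fin d) :
    dhol V ψ ((L : ℤ) • y) (seg κ (L : ℤ)) = Ad (hol V ((L : ℤ) • y) (seg κ (L : ℤ))) (ψ (faceSite L y κ) κ) := by
  let r₀ : Fin d → Fin L := fun _ => ⟨0, hL⟩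
  have hr₀ : boxVec L r₀ = 0 := by funext i; simp [boxVec, r₀]
  have h := dhol_seg_cross (V := V) hL hψ y κ r₀
  rw [hr₀, add_zero] at h
  rw [h, faceSite_eq hL]
  have e1 : (((L - 1 - ((r₀ κ : ℕ)) : ℕ) : ℤ) + 1) = (L : ℤ) := by simp only [r₀]; omega
  rw [e1]

/-- The reversed central contour: `(δ_ψV)(−Γ_c from Ly + Le_κ) = −ψ(b₀)`. [folklore] -/
theorem dhol_back {L : ℕ} {V : Site d → Fin d → (Matrix n n ℂ)ˣ} {ψ : Site d → Fin d → (Matrix n n ℂ)} (hL : 1 ≤ L)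
    (hψ : CrossSupported L ψ) (y : Site d) (κ : Fin d) :
    dhol V ψ ((L : ℤ) • y + (L : ℤ) • e κ) (seg κ (-(L : ℤ))) = -ψ (faceSite L y κ) κ := by
  obtain ⟨k, hk⟩ : ∃ k : ℕ, L = k + 1 := ⟨L - 1, by omega⟩
  have h := dhol_seg_neg_head V (ψ := ψ) ((L : ℤ) • y + (L : ℤ) • e κ) κ k fun j hj => hψ _ _ fun hc => ?_
  · rw [hk] at h ⊢
    rw [h]
    congr 2
    simp only [faceSite]
    push_cast
    module
  · have hj' : j + 1 < L := by omega
    have := (isCross_back_iff hL y κ hj').mp (by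
      rw [show (((j + 1 : ℕ) : ℤ) + 1) • e κ = ((j : ℤ) + 2) • e κ by push_cast; ring_nf]; exact hc)
    omega

omit [Fintype n] [DecidableEq n] in
/-- The contour `Γ_{c,x}` split at the end of its crossing bond:
`Γ_{c,x} = (Γ_{Ly,x} ∪ [x, b_x₊]) ∪ ([b_x₊, x + Le_κ] ∪ −Γ_{L(y+e_κ), x+Le_κ})`. [cite: Balaban1985Averaging, (14) p.19] -/
theorem gammaWord_split {L : ℕ} (κ : Fin d) (r : Fin d → Fin L) :
    gammaWord L κ (boxVec L r)
      = (treeWord (boxVec L r) ++ seg κ (((L - 1 - (r κ : ℕ) : ℕ) : ℤ) + 1))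
        ++ (seg κ ((r κ : ℕ) : ℤ) ++ revWord (treeWord (boxVec L r))) := by
  have hr := (r κ).isLt
  rw [gammaWord, List.append_assoc, List.append_assoc]
  congr 1
  rw [← List.append_assoc]
  congr 1
  rw [show (((L - 1 - (r κ : ℕ) : ℕ) : ℤ) + 1) = ((L - (r κ : ℕ) : ℕ) : ℤ) by omega, seg_natCast, seg_natCast,
    seg_natCast, ← List.replicate_add]
  congr 1
  omega

omit [Fintype n] [DecidableEq n] in
/-- The end point of the first half: `Ly + disp(Γ_{Ly,x} ∪ [x, b_x₊]) = L(y + e_κ) + boxVec (perpOff r)`. [folklore] -/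
theorem disp_firstHalf {L : ℕ} (hL : 1 ≤ L) (y : Site d) (κ : Fin d) (r : Fin d → Fin L) :
    (L : ℤ) • y + disp (treeWord (boxVec L r) ++ seg κ (((L - 1 - (r κ : ℕ) : ℕ) : ℤ) + 1))
      = (L : ℤ) • (y + e κ) + boxVec L (perpOff hL κ r) := by
  rw [disp_append, disp_treeWord, disp_seg, smul_add, add_assoc]
  congr 1
  have h := boxVec_crossOff_add_e hL κ r
  rw [boxVec_crossOff] at h
  rw [← h, add_assoc, add_smul, one_smul]

/-- **THE LOOP `Γ_{c,x} ∪ (−Γ_c)`** for a cross-supported direction: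
`(δ_ψV)(loop) = Ad_{V(Γ_{Ly,x} ∪ [x, b_x₊])}ψ(b_x) − Ad_{V(Γ_{c,x})}ψ(b₀)`. [cite: Balaban1985Averaging, (42) p.23] -/
theorem dhol_loopWord {L : ℕ} {V : Site d → Fin d → (Matrix n n ℂ)ˣ} {ψ : Site d → Fin d → (Matrix n n ℂ)} (hL : 1 ≤ L)
    (hψ : CrossSupported L ψ) (y : Site d) (κ : Fin d) (r : Fin d → Fin L) :
    dhol V ψ ((L : ℤ) • y) (loopWord L κ (boxVec L r))
      = Ad (hol V ((L : ℤ) • y) (treeWord (boxVec L r) ++ seg κ (((L - 1 - (r κ : ℕ) : ℕ) : ℤ) + 1)))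
          (ψ ((L : ℤ) • y + boxVec L (crossOff hL κ r)) κ)
        - Ad (hol V ((L : ℤ) • y) (gammaWord L κ (boxVec L r))) (ψ (faceSite L y κ) κ) := by
  -- the loop = gammaWord ++ back
  rw [loopWord, dhol_append, disp_gammaWord, dhol_back hL hψ y κ, Ad_neg, ← sub_eq_add_neg]
  congr 1
  rw [gammaWord, dhol_append, disp_append, disp_treeWord, disp_seg]
  -- the reversed tree word vanishes
  have hrev : dhol V ψ ((L : ℤ) • y + (boxVec L r + (L : ℤ) • e κ)) (revWord (treeWord (boxVec L r))) = 0 := by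
    have h := dhol_revWord V ψ ((L : ℤ) • y + (L : ℤ) • e κ) (treeWord (boxVec L r))
    rw [disp_treeWord, show (L : ℤ) • y + (L : ℤ) • e κ + boxVec L r = (L : ℤ) • y + (boxVec L r + (L : ℤ) • e κ)
      by abel] at h
    rw [h, show (L : ℤ) • y + (L : ℤ) • e κ = (L : ℤ) • (y + e κ) by rw [smul_add],
      dhol_treeWord_eq_zero hL hψ (y + e κ) r, Ad_zero, neg_zero]
  rw [hrev, Ad_zero, add_zero, dhol_append, disp_treeWord, dhol_treeWord_eq_zero hL hψ y r, zero_add,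
    dhol_seg_cross hL hψ y κ r, ← Ad_mul, hol_append, disp_treeWord]

/-- **`Φ(c) = ψ(b₀(c)) + Ad_{V(Γ_c)⁻¹} J_{X_c}(X_c′)`** for a cross-supported `ψ`. [cite: Balaban1985Averaging, (42) p.23] -/
theorem pushDir_crossSupported {L : ℕ} {V : Site d → Fin d → (Matrix n n ℂ)ˣ} {ψ : Site d → Fin d → (Matrix n n ℂ)} (hL : 1 ≤ L)
    (hψ : CrossSupported L ψ) (y : Site d) (κ : Fin d) :
    pushDir L V ψ ((L : ℤ) • y) κ
      = ψ (faceSite L y κ) κ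
        + Ad (hol V ((L : ℤ) • y) (seg κ (L : ℤ)))⁻¹
            (jexp (Xavg L V ((L : ℤ) • y) κ) (XavgDeriv L V ψ ((L : ℤ) • y) κ)) := by
  rw [pushDir, sideDeriv, dhol_central hL hψ y κ, ← Ad_mul, Ad_add, ← Ad_mul]
  have e1 : (bavg L V ((L : ℤ) • y) κ)⁻¹ * expUnit (Xavg L V ((L : ℤ) • y) κ) * hol V ((L : ℤ) • y) (seg κ (L : ℤ))
      = 1 := by
    rw [bavg]; group
  have e2 : (bavg L V ((L : ℤ) • y) κ)⁻¹ * expUnit (Xavg L V ((L : ℤ) • y) κ)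
      = (hol V ((L : ℤ) • y) (seg κ (L : ℤ)))⁻¹ := by
    rw [bavg]; group
  rw [e1, e2, Ad_one, add_comm]

end

end Summit.QuantumFields.BalabanUV.T4Continuum.SpreadLiftWords
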